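import Literature.Analysis.FluidPDE.PlanarPolarCoords
import HarnessLib

/-!
# Wirtinger's inequality on circles and its planar (polar) integrated forms

Analysis/FluidPDE file (all results proved). For a `C¹` planar function `g` and a radius `r`,
the trace `θ ↦ g(r cos θ, r sin θ)` is `2π`-periodic with derivative
`θ ↦ Dg(ξ)[ξ^⊥]`, `ξ = circlePt r θ`; Wirtinger's inequality (Parseval on an interval,
`hasSum_sq_fourierCoeffOn`) gives

* `∫ (g − ḡ(r))² dθ ≤ ∫ (Dg ξ^⊥)² dθ` (modes `n ≠ 0`), `ḡ(r)` the circular mean;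
* `4 ∫ g² dθ ≤ ∫ (Dg ξ^⊥)² dθ` when `g` is even and has zero circular means (an even function is
  `π`-periodic on every circle, so only the modes `|n| ≥ 2` occur).

Integrating in `r` with a radial weight (polar coordinates, `integral_eq_integral_circlePt`)
gives the planar forms used for the angular (non-radial) part of a vorticity.

## References

* G. H. Hardy, J. E. Littlewood, G. Pólya, *Inequalities*, CUP 1952, §7.7 Thm. 258.
* Y. Maekawa, Math. Models Methods Appl. Sci. 19 (2009), §4 (use of the even sector).
  [Maekawa2009b]
-/

noncomputable section

open Set Function Filter MeasureTheory Real
open scoped Topology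

namespace Literature.Analysis.FluidPDE

/-! ### Wirtinger's inequality on an interval of arbitrary length -/

/-- A continuous function is square integrable on `(a, b]`. [folklore] -/
theorem memLp_two_Ioc_of_continuous' {f : ℝ → ℂ} (hf : Continuous f) (a b : ℝ) :
    MemLp f 2 (volume.restrict (Ioc a b)) := by
  obtain ⟨C, hC⟩ := (isCompact_Icc (a := a) (b := b)).exists_bound_of_continuousOn hf.continuousOn
  have htop : MemLp f ⊤ (volume.restrict (Ioc a b)) := by
    refine memLp_top_of_bound hf.aestronglyMeasurable C ?_
    rw [ae_restrict_iff' measurableSet_Ioc]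
    exact Eventually.of_forall fun x hx => hC x (Ioc_subset_Icc_self hx)
  exact htop.mono_exponent le_top

/-- **Wirtinger's inequality on `[a, b]`** (zero-mean form): for `f : ℝ → ℂ` with continuous
derivative `f'`, `f(b) = f(a)` and `∫_a^b f = 0`,
`(2π/(b−a))² ∫_a^b |f|² ≤ ∫_a^b |f'|²` (Parseval and `c_n(f') = 2πin/(b−a) · c_n(f)`).
[folklore] -/
theorem wirtinger_interval {f f' : ℝ → ℂ} {a b : ℝ} (hab : a < b)
    (hf : ∀ x, HasDerivAt f (f' x) x) (hf' : Continuous f') (hper : f b = f a)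
    (hmean : ∫ x in a..b, f x = 0) :
    (2 * π / (b - a)) ^ 2 * ∫ x in a..b, ‖f x‖ ^ 2 ≤ ∫ x in a..b, ‖f' x‖ ^ 2 := by
  have hfc : Continuous f := continuous_iff_continuousAt.mpr fun x => (hf x).continuousAt
  have hba : 0 < b - a := sub_pos.2 hab
  have Pf := hasSum_sq_fourierCoeffOn hab (memLp_two_Ioc_of_continuous' hfc a b)
  have Pf' := hasSum_sq_fourierCoeffOn hab (memLp_two_Ioc_of_continuous' hf' a b)
  simp only [smul_eq_mul] at Pf Pf'
  have hterm : ∀ n : ℤ, (2 * π / (b - a)) ^ 2 * ‖fourierCoeffOn hab f n‖ ^ 2 ≤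
      ‖fourierCoeffOn hab f' n‖ ^ 2 := by
    intro n
    by_cases hn : n = 0
    · subst hn
      have h0 : fourierCoeffOn hab f 0 = 0 := by
        rw [fourierCoeffOn_eq_integral f 0 hab]
        simp [hmean]
      rw [h0, norm_zero, zero_pow two_ne_zero, mul_zero]
      positivity
    · have h := fourierCoeffOn_of_hasDerivAt hab hn (fun x _ => hf x) (hf'.intervalIntegrable _ _)
      rw [hper, sub_self, mul_zero, zero_sub] at h
      have hI : (2 * π * Complex.I * n : ℂ) ≠ 0 := by
        have : (n : ℂ) ≠ 0 := by exact_mod_cast hn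
        have hπ : (π : ℂ) ≠ 0 := by exact_mod_cast Real.pi_ne_zero
        simp [this, hπ, Complex.I_ne_zero]
      have key : (2 * π * Complex.I * n) * fourierCoeffOn hab f n = (b - a) * fourierCoeffOn hab f' n := by
        rw [h]; field_simp
      have hn1 : (1 : ℝ) ≤ |(n : ℝ)| := by
        rw [← Int.cast_abs]; exact_mod_cast Int.one_le_abs hn
      have e1 : ‖(2 * π * Complex.I * n : ℂ)‖ = 2 * π * |(n : ℝ)| := by
        rw [norm_mul, norm_mul, norm_mul, Complex.norm_I, mul_one, Complex.norm_intCast,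
          Complex.norm_real, Real.norm_of_nonneg Real.pi_pos.le, Complex.norm_two]
      have e2 : ‖((b : ℂ) - a)‖ = b - a := by
        rw [show ((b : ℂ) - a) = ((b - a : ℝ) : ℂ) by push_cast; ring, Complex.norm_real,
          Real.norm_of_nonneg hba.le]
      have hnorm : 2 * π * |(n : ℝ)| * ‖fourierCoeffOn hab f n‖ = (b - a) * ‖fourierCoeffOn hab f' n‖ := by
        rw [← e1, ← e2, ← norm_mul, ← norm_mul, key]
      -- `(2π/(b-a))² ‖c‖² ≤ (2π|n|/(b-a))² ‖c‖² = ‖c'‖²`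
      have h0 : 0 ≤ ‖fourierCoeffOn hab f n‖ := norm_nonneg _
      have e3 : ‖fourierCoeffOn hab f' n‖ = 2 * π * |(n : ℝ)| / (b - a) * ‖fourierCoeffOn hab f n‖ := by
        field_simp; linarith
      rw [e3, mul_pow, div_pow, div_pow]
      have h4 : (2 * π) ^ 2 ≤ (2 * π * |(n : ℝ)|) ^ 2 := by
        apply pow_le_pow_left₀ (by positivity); nlinarith [Real.pi_pos]
      have h5 : 0 ≤ ‖fourierCoeffOn hab f n‖ ^ 2 := sq_nonneg _
      have h6 : 0 < (b - a) ^ 2 := by positivity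
      calc (2 * π) ^ 2 / (b - a) ^ 2 * ‖fourierCoeffOn hab f n‖ ^ 2
          ≤ (2 * π * |(n : ℝ)|) ^ 2 / (b - a) ^ 2 * ‖fourierCoeffOn hab f n‖ ^ 2 := by gcongr
        _ = _ := rfl
  have h := hasSum_le hterm (Pf.mul_left ((2 * π / (b - a)) ^ 2)) Pf'
  -- `h : (2π/(b-a))² ((b-a)⁻¹ ∫|f|²) ≤ (b-a)⁻¹ ∫ |f'|²`
  have hinv : 0 < (b - a)⁻¹ := inv_pos.2 hba
  have := mul_le_mul_of_nonneg_left h hba.le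
  calc (2 * π / (b - a)) ^ 2 * ∫ x in a..b, ‖f x‖ ^ 2
      = (b - a) * ((2 * π / (b - a)) ^ 2 * ((b - a)⁻¹ * ∫ x in a..b, ‖f x‖ ^ 2)) := by
        field_simp
    _ ≤ (b - a) * ((b - a)⁻¹ * ∫ x in a..b, ‖f' x‖ ^ 2) := this
    _ = _ := by field_simp

/-- **Wirtinger's inequality, real form**: for `c : ℝ → ℝ` with continuous derivative `c'`,
`c(b) = c(a)` and `∫_a^b c = 0`, `(2π/(b−a))² ∫_a^b c² ≤ ∫_a^b c'²`. [folklore] -/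
theorem wirtinger_interval_real {c c' : ℝ → ℝ} {a b : ℝ} (hab : a < b)
    (hc : ∀ x, HasDerivAt c (c' x) x) (hc' : Continuous c') (hper : c b = c a)
    (hmean : ∫ x in a..b, c x = 0) :
    (2 * π / (b - a)) ^ 2 * ∫ x in a..b, c x ^ 2 ≤ ∫ x in a..b, c' x ^ 2 := by
  have h := wirtinger_interval (f := fun x => (c x : ℂ)) (f' := fun x => (c' x : ℂ)) hab
    (fun x => (hc x).ofReal_comp) (Complex.continuous_ofReal.comp hc') (by simp [hper])
    (by rw [intervalIntegral.integral_ofReal, hmean]; simp)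
  simpa only [Complex.norm_real, Real.norm_eq_abs, sq_abs] using h

/-! ### Traces of planar functions on circles -/

/-- `circlePt (−r) θ = −circlePt r θ`. [folklore] -/
theorem circlePt_neg_left (r θ : ℝ) : circlePt (-r) θ = -circlePt r θ := by
  ext i; fin_cases i <;> simp

/-- The trace `θ ↦ g(circlePt r θ)` of a differentiable `g` has derivative `Dg(ξ)[ξ^⊥]`.
[folklore] -/
theorem hasDerivAt_comp_circlePt {g : EuclideanSpace ℝ (Fin 2) → ℝ} (hg : Differentiable ℝ g) (r θ : ℝ) :
    HasDerivAt (fun θ : ℝ => g (circlePt r θ)) (fderiv ℝ g (circlePt r θ) (perp (circlePt r θ))) θ :=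
  (hg _).hasFDerivAt.comp_hasDerivAt θ (hasDerivAt_circlePt r θ)

/-- Continuity of `θ ↦ Dg(circlePt r θ)[(circlePt r θ)^⊥]` for `g ∈ C¹`. [folklore] -/
theorem continuous_fderiv_comp_circlePt_perp {g : EuclideanSpace ℝ (Fin 2) → ℝ} (hg : ContDiff ℝ 1 g) (r : ℝ) :
    Continuous fun θ : ℝ => fderiv ℝ g (circlePt r θ) (perp (circlePt r θ)) :=
  ((hg.continuous_fderiv one_ne_zero).comp (continuous_circlePt r)).clm_apply
    (continuous_perp_circlePt r)

/-- **Wirtinger on a circle, mean form**: for `g ∈ C¹(ℝ²)` and any radius `r`,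
`∫ (g(circlePt r θ) − ḡ(r))² dθ ≤ ∫ (Dg ξ^⊥)² dθ` over a full turn, `ḡ(r)` the circular mean.
[folklore] -/
theorem circle_wirtinger_mean {g : EuclideanSpace ℝ (Fin 2) → ℝ} (hg : ContDiff ℝ 1 g) (r : ℝ) :
    ∫ θ in (-π)..π, (g (circlePt r θ) - (2 * π)⁻¹ * ∫ t in (-π)..π, g (circlePt r t)) ^ 2 ≤
      ∫ θ in (-π)..π, (fderiv ℝ g (circlePt r θ) (perp (circlePt r θ))) ^ 2 := by
  have hd := hg.differentiable one_ne_zero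
  have hgc : Continuous fun θ : ℝ => g (circlePt r θ) := hg.continuous.comp (continuous_circlePt r)
  have hc : ∀ θ, HasDerivAt (fun θ : ℝ => g (circlePt r θ) - (2 * π)⁻¹ * ∫ t in (-π)..π, g (circlePt r t))
      (fderiv ℝ g (circlePt r θ) (perp (circlePt r θ))) θ :=
    fun θ => (hasDerivAt_comp_circlePt hd r θ).sub_const _
  have hper : g (circlePt r π) - (2 * π)⁻¹ * (∫ t in (-π)..π, g (circlePt r t)) =
      g (circlePt r (-π)) - (2 * π)⁻¹ * ∫ t in (-π)..π, g (circlePt r t) := by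
    have h := periodic_circlePt r (-π)
    simp only at h
    rw [show -π + 2 * π = π by ring] at h
    rw [h]
  have hmean : ∫ θ in (-π)..π, (g (circlePt r θ) - (2 * π)⁻¹ * ∫ t in (-π)..π, g (circlePt r t)) = 0 := by
    rw [intervalIntegral.integral_sub (hgc.intervalIntegrable _ _) intervalIntegrable_const,
      intervalIntegral.integral_const, smul_eq_mul]
    have hπ : π ≠ 0 := Real.pi_ne_zero
    field_simp
    ring
  have h := wirtinger_interval_real (by linarith [Real.pi_pos] : -π < π) hc
    (continuous_fderiv_comp_circlePt_perp hg r) hper hmean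
  have h2 : (2 * π / (π - -π)) ^ 2 = 1 := by
    rw [show π - -π = 2 * π by ring, div_self (by positivity)]; norm_num
  rwa [h2, one_mul] at h

/-- **Wirtinger on a circle, even sector**: if `g ∈ C¹(ℝ²)` is even and has zero mean on the circle
of radius `r`, then `4 ∫ g(circlePt r θ)² dθ ≤ ∫ (Dg ξ^⊥)² dθ` over a full turn (an even function
is `π`-periodic on circles: apply Wirtinger on the two half-turns). [folklore] -/
theorem circle_wirtinger_even {g : EuclideanSpace ℝ (Fin 2) → ℝ} (hg : ContDiff ℝ 1 g) (heven : ∀ x, g (-x) = g x) (r : ℝ)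
    (hmean : ∫ θ in (-π)..π, g (circlePt r θ) = 0) :
    4 * ∫ θ in (-π)..π, g (circlePt r θ) ^ 2 ≤
      ∫ θ in (-π)..π, (fderiv ℝ g (circlePt r θ) (perp (circlePt r θ))) ^ 2 := by
  have hd := hg.differentiable one_ne_zero
  have hcc : Continuous fun θ : ℝ => g (circlePt r θ) := hg.continuous.comp (continuous_circlePt r)
  have hc'c := continuous_fderiv_comp_circlePt_perp hg r
  have hc : ∀ θ, HasDerivAt (fun θ : ℝ => g (circlePt r θ))
      (fderiv ℝ g (circlePt r θ) (perp (circlePt r θ))) θ := fun θ => hasDerivAt_comp_circlePt hd r θ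
  have hπ : ∀ θ : ℝ, g (circlePt r (θ + π)) = g (circlePt r θ) := fun θ => by
    rw [circlePt_add_pi, circlePt_neg_left, heven]
  have hpos : 0 < π := Real.pi_pos
  -- the two half-turns have equal integrals, hence both vanish
  have hhalf : ∫ θ in (-π)..0, g (circlePt r θ) = ∫ θ in (0:ℝ)..π, g (circlePt r θ) := by
    have h := intervalIntegral.integral_comp_add_right (a := -π) (b := 0)
      (fun θ : ℝ => g (circlePt r θ)) π
    simp only [hπ, neg_add_cancel, zero_add] at h
    exact h
  have hsum : (∫ θ in (-π)..0, g (circlePt r θ)) + ∫ θ in (0:ℝ)..π, g (circlePt r θ) = 0 := by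
    rw [intervalIntegral.integral_add_adjacent_intervals (hcc.intervalIntegrable _ _)
      (hcc.intervalIntegrable _ _)]
    exact hmean
  have h0 : ∫ θ in (0:ℝ)..π, g (circlePt r θ) = 0 := by linarith
  have h1 : ∫ θ in (-π)..0, g (circlePt r θ) = 0 := by linarith
  have wl := wirtinger_interval_real (by linarith : -π < 0) hc hc'c
    (by have := hπ (-π); rwa [neg_add_cancel] at this) h1
  have wr := wirtinger_interval_real hpos hc hc'c (by have := hπ 0; rwa [zero_add] at this) h0
  have e1 : (2 * π / (0 - -π)) ^ 2 = 4 := by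
    rw [show (0:ℝ) - -π = π by ring, show 2 * π / π = 2 by field_simp]; norm_num
  have e2 : (2 * π / (π - 0)) ^ 2 = 4 := by
    rw [sub_zero, show 2 * π / π = 2 by field_simp]; norm_num
  rw [e1] at wl
  rw [e2] at wr
  have hcc2 : Continuous fun θ : ℝ => g (circlePt r θ) ^ 2 := hcc.pow 2
  have hc'c2 : Continuous fun θ : ℝ => (fderiv ℝ g (circlePt r θ) (perp (circlePt r θ))) ^ 2 := hc'c.pow 2
  rw [← intervalIntegral.integral_add_adjacent_intervals (b := 0) (hcc2.intervalIntegrable _ _)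
    (hcc2.intervalIntegrable _ _), ← intervalIntegral.integral_add_adjacent_intervals (b := 0)
    (hc'c2.intervalIntegrable _ _) (hc'c2.intervalIntegrable _ _)]
  linarith

/-! ### Planar forms (integration over the radius) -/

/-- **Planar Wirtinger, even sector**: for an even `h ∈ C¹(ℝ²)` with zero circular means and a
radial weight `ρ ≥ 0`, `4 ∫ ρ(|x|) h² ≤ ∫ ρ(|x|) (Dh x^⊥)²` (given the integrability of both
sides). [folklore] -/
theorem planar_wirtinger_even {h : EuclideanSpace ℝ (Fin 2) → ℝ} (hh : ContDiff ℝ 1 h) (heven : ∀ x, h (-x) = h x)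
    (hmean : ∀ r, 0 < r → ∫ θ in (-π)..π, h (circlePt r θ) = 0) {ρ : ℝ → ℝ}
    (hρ : ∀ r, 0 < r → 0 ≤ ρ r) (h1 : Integrable fun x => ρ ‖x‖ * h x ^ 2)
    (h2 : Integrable fun x => ρ ‖x‖ * (fderiv ℝ h x (perp x)) ^ 2) :
    4 * ∫ x, ρ ‖x‖ * h x ^ 2 ≤ ∫ x, ρ ‖x‖ * (fderiv ℝ h x (perp x)) ^ 2 := by
  rw [← integral_const_mul, integral_eq_integral_circlePt (h1.const_mul 4),
    integral_eq_integral_circlePt h2]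
  refine setIntegral_mono_on ((integrable_circlePt_smul (h1.const_mul 4)).integral_prod_left)
    ((integrable_circlePt_smul h2).integral_prod_left) measurableSet_Ioi fun r hr => ?_
  have hr : 0 < r := hr
  have hπ : -π ≤ π := by linarith [Real.pi_pos]
  simp only [smul_eq_mul, norm_circlePt, abs_of_pos hr]
  rw [← intervalIntegral.integral_of_le hπ, ← intervalIntegral.integral_of_le hπ]
  simp only [intervalIntegral.integral_const_mul]
  have hw := circle_wirtinger_even hh heven r (hmean r hr)
  have h0 : 0 ≤ r * ρ r := mul_nonneg hr.le (hρ r hr)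
  nlinarith

/-- **Planar Wirtinger, mean form**: for `g ∈ C¹(ℝ²)` and a radial weight `ρ ≥ 0`,
`∫ ρ(|x|) (g − ḡ(|x|))² ≤ ∫ ρ(|x|) (Dg x^⊥)²`, where `ḡ(r) = (2π)⁻¹∫ g(circlePt r t) dt` is the
circular mean (given the integrability of both sides). [folklore] -/
theorem planar_wirtinger_mean {g : EuclideanSpace ℝ (Fin 2) → ℝ} (hg : ContDiff ℝ 1 g) {ρ : ℝ → ℝ}
    (hρ : ∀ r, 0 < r → 0 ≤ ρ r)
    (h1 : Integrable fun x => ρ ‖x‖ * (g x - (2 * π)⁻¹ * ∫ t in (-π)..π, g (circlePt ‖x‖ t)) ^ 2)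
    (h2 : Integrable fun x => ρ ‖x‖ * (fderiv ℝ g x (perp x)) ^ 2) :
    ∫ x, ρ ‖x‖ * (g x - (2 * π)⁻¹ * ∫ t in (-π)..π, g (circlePt ‖x‖ t)) ^ 2 ≤
      ∫ x, ρ ‖x‖ * (fderiv ℝ g x (perp x)) ^ 2 := by
  rw [integral_eq_integral_circlePt h1, integral_eq_integral_circlePt h2]
  refine setIntegral_mono_on ((integrable_circlePt_smul h1).integral_prod_left)
    ((integrable_circlePt_smul h2).integral_prod_left) measurableSet_Ioi fun r hr => ?_
  have hr : 0 < r := hr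
  have hπ : -π ≤ π := by linarith [Real.pi_pos]
  simp only [smul_eq_mul, norm_circlePt, abs_of_pos hr]
  rw [← intervalIntegral.integral_of_le hπ, ← intervalIntegral.integral_of_le hπ]
  simp only [intervalIntegral.integral_const_mul]
  have hw := circle_wirtinger_mean hg r
  have h0 : 0 ≤ r * ρ r := mul_nonneg hr.le (hρ r hr)
  nlinarith

/-! ### The circular mean -/

/-- The circular mean `r ↦ (2π)⁻¹ ∫ g(circlePt r t) dt` of a continuous `g` is continuous.
[folklore] -/
theorem continuous_circleMean {g : EuclideanSpace ℝ (Fin 2) → ℝ} (hg : Continuous g) :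
    Continuous fun r : ℝ => (2 * π)⁻¹ * ∫ t in (-π)..π, g (circlePt r t) := by
  refine continuous_const.mul ?_
  have h : Continuous (uncurry fun (r t : ℝ) => g (circlePt r t)) := hg.comp continuous_circlePt_uncurry
  exact intervalIntegral.continuous_parametric_intervalIntegral_of_continuous' h (-π) π

/-- **Pythagoras on a circle**: `∫ g² dθ = ∫ (g − ḡ)² dθ + 2π ḡ²`. [folklore] -/
theorem integral_sq_comp_circlePt_eq {g : EuclideanSpace ℝ (Fin 2) → ℝ} (hg : Continuous g) (r : ℝ) :
    ∫ θ in (-π)..π, g (circlePt r θ) ^ 2 =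
      (∫ θ in (-π)..π, (g (circlePt r θ) - (2 * π)⁻¹ * ∫ t in (-π)..π, g (circlePt r t)) ^ 2) +
        2 * π * ((2 * π)⁻¹ * ∫ t in (-π)..π, g (circlePt r t)) ^ 2 := by
  have hgc : Continuous fun θ : ℝ => g (circlePt r θ) := hg.comp (continuous_circlePt r)
  set μ := (2 * π)⁻¹ * ∫ t in (-π)..π, g (circlePt r t) with hμ
  have hI : ∫ t in (-π)..π, g (circlePt r t) = 2 * π * μ := by
    rw [hμ]; field_simp
  have hexp : ∀ θ : ℝ, (g (circlePt r θ) - μ) ^ 2 = g (circlePt r θ) ^ 2 - 2 * μ * g (circlePt r θ) + μ ^ 2 :=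
    fun θ => by ring
  simp_rw [hexp]
  have c1 : Continuous fun θ : ℝ => g (circlePt r θ) ^ 2 := hgc.pow 2
  have c2 : Continuous fun θ : ℝ => 2 * μ * g (circlePt r θ) := continuous_const.mul hgc
  have c3 : Continuous fun θ : ℝ => g (circlePt r θ) ^ 2 - 2 * μ * g (circlePt r θ) := c1.sub c2
  rw [intervalIntegral.integral_add (c3.intervalIntegrable _ _) intervalIntegrable_const,
    intervalIntegral.integral_sub (c1.intervalIntegrable _ _) (c2.intervalIntegrable _ _),
    intervalIntegral.integral_const_mul, intervalIntegral.integral_const, hI, smul_eq_mul]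
  ring

/-- **The mean is bounded by the quadratic mean**: `2π ḡ(r)² ≤ ∫ g² dθ`. [folklore] -/
theorem two_pi_mul_circleMean_sq_le {g : EuclideanSpace ℝ (Fin 2) → ℝ} (hg : Continuous g) (r : ℝ) :
    2 * π * ((2 * π)⁻¹ * ∫ t in (-π)..π, g (circlePt r t)) ^ 2 ≤ ∫ θ in (-π)..π, g (circlePt r θ) ^ 2 := by
  rw [integral_sq_comp_circlePt_eq hg r]
  have : 0 ≤ ∫ θ in (-π)..π, (g (circlePt r θ) - (2 * π)⁻¹ * ∫ t in (-π)..π, g (circlePt r t)) ^ 2 :=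
    intervalIntegral.integral_nonneg (by linarith [Real.pi_pos]) fun θ _ => sq_nonneg _
  linarith

end Literature.Analysis.FluidPDE
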